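import Summits.CriticalPhenomena.PercolationContinuityZ3.Theorems.PercNearOneGluingNoHeavyQuantBlockCombHairRow
import HarnessLib

/-!
# QUANT lane R8, FAR on trees beyond block-combs: the MIXTURE WRAPPER in the canonical model — every x-admissible side law gives the row
# (`Quant.BlockComb.tail_ge_of_mixture`, `Quant.BlockComb.tail_ge_of_mixture_law`)

builds on p205010 (kernel theorem, internal audit signed; external expert review pending)

Support file (`--supports stmt-CriticalPhenomena-4575`), QUANT lane typer seat prim-quant-stmt (gen 16); lead g14's typer asks (lane INBOX
2026-08-21T04:41Z (2) "an 'x-admissible' closure toolkit in the canonical model" and 04:55Z "the 'x-admissible law ⟹ row' wrapper in the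
canonical model (linear combination of `tail_ge_of_mean` instances over a finite mixture), so that any admissibility proof plugs in";
LEAD-NOTES-G14 N25 addendum 2 / (6): conjecture (MIX-units)).  Theorems only (the `local notation3` of `…QuantBlockCombMergeModel.lean`,
verbatim), no definitions, no sorries, standard axioms.  Generalises the two-component proofs of census-1 g13's `tail_ge_of_mean_hair` /
`tail_ge_of_mean_threePoint` (p248279 / p248357) to arbitrary finite mixtures of arbitrary independent-blob components.

SETTING.  Canonical block-comb (`D`, chain gates `q`, levels `lv`, sizes `a`, private gates `g`), a spare SURE index `u` (`a u = 0`, `g u = 1`)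
at the side level `l = lv u ≤ D`, and a pool `B ∌ u` of spare DEAD indices at the same level (`a = 0` on `B`).  A COMPONENT is an independent
blob collection on the pool: sizes `s : κ → ℕ` and gates `γ : κ → ℝ` read on `B`; its configuration `S ⊆ B` has weight
`wt_γ^B(S) = ∏_{β∈B} (γ β if β ∈ S else 1 − γ β)` and carries `Σ_{β∈S} s β` relays.  `T h = TAIL[D, q, lv, a[u ↦ h], g, j]` is the block-comb
tail with a sure blob of size `h` at the side level (as in `tail_ge_of_mean_hair`, and as produced on the gate side by
`Quant.BlockCombGate.real_heavy_side_eq_sum`, p248816).  A side law `π` on `{0, …, N}` is x-ADMISSIBLE (lead g14) when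
`π h = Σ_r λ_r · wt_{γ_r}^B{S ⊆ B : Σ_S s_r = h}` for a finite convex combination of components whose live blobs have marginal
`(∏_{i<l} q)·γ_r β ≥ x` and whose means `Σ_β s_r β·γ_r β` all equal one number `m̄`.

* `Quant.BlockComb.sum_mul_apply_eq_sum_fiber` — regrouping a configuration sum by the value of a bounded statistic (law form).
* `Quant.BlockComb.tail_pool_eq_sum` — **configuration expansion**: planting a component on the pool,
  `TAIL[D, q, lv, (s on B, a[u ↦ h] off B), (γ on B, g off B), j] = Σ_{S ⊆ B} wt_γ^B(S) · T(h + Σ_{β∈S} s β)`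
  (induction on `B`: `tail_gate_split`, `tail_sure_transfer` onto `u`, `tail_update_dead`).
* `Quant.BlockComb.tail_ge_of_mixture` — **THE MIXTURE WRAPPER (configuration form)**: floor `0 < x ≤ ∏_{i<D} q`, live block-comb marginals
  `≥ x`, components `r ∈ R` with weights `λ_r ≥ 0`, `Σ λ_r = 1`, gates in `[0,1]`, live component marginals `≥ x`, common mean `m̄`, budget
  `2j < Σ_k a k·marginal k + (∏_{i<l} q)·m̄` ⟹ `x ≤ Σ_r λ_r Σ_{S ⊆ B} wt_{γ_r}^B(S) · T(Σ_{β∈S} s_r β)` (one `tail_ge_of_mean_le` per component).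
* `Quant.BlockComb.tail_ge_of_mixture_law` — **law form**: if moreover `π h = Σ_r λ_r · wt_{γ_r}^B{S : Σ_S s_r = h}` for `h ≤ N` and every
  component carries at most `N` relays, then `x ≤ Σ_{h ≤ N} π h · T h` — "x-admissible law ⟹ row"; with p248816's gate-side identity and
  `sum_mul_apply_eq_sum_fiber` this is FAR in gate coordinates for every side structure whose law is x-admissible.
[cite: KozmaNitzan2024, Conjecture 3 (p. 15)] (the gluing rows served); the wrapper is [this work].
-/

noncomputable section

namespace Summit.CriticalPhenomena.PercolationContinuityZ3.Theorems

namespace Quant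

open Finset

namespace BlockComb

variable {κ : Type*} [Fintype κ] [DecidableEq κ]

/-- product-Bernoulli weight of the set `S` of open blob gates -/
local notation3 "wt[" g ", " S "]" => ∏ k, (if k ∈ (S : Finset κ) then (g : κ → ℝ) k else 1 - (g : κ → ℝ) k)
/-- probability that the chain `q` of length `D` is open exactly to depth `i` -/
local notation3 "pd[" D ", " q ", " i "]" =>
  (∏ i' ∈ Finset.range (i : ℕ), (q : ℕ → ℝ) i') * (if (i : ℕ) < (D : ℕ) then 1 - (q : ℕ → ℝ) i else 1)
/-- mass counted at depth `i` in blob configuration `S` -/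
local notation3 "mass[" lv ", " a ", " i ", " S "]" =>
  ∑ k ∈ (S : Finset κ).filter (fun k => (lv : κ → ℕ) k ≤ (i : ℕ)), ((a : κ → ℕ) k : ℕ)
/-- the tail `P(N ≥ j+1)` of the block-comb count, as an explicit finite sum -/
local notation3 "TAIL[" D ", " q ", " lv ", " a ", " g ", " j "]" =>
  ∑ i ∈ Finset.range ((D : ℕ) + 1), pd[D, q, i] *
    ∑ S : Finset κ, wt[g, S] * (if (j : ℕ) + 1 ≤ mass[lv, a, i, S] then (1 : ℝ) else 0)

/-! ### 0. Regrouping by the value of a statistic -/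

omit [Fintype κ] [DecidableEq κ] in
/-- Regrouping a weighted configuration sum by the value of a bounded `ℕ`-statistic: `Σ_U w U·F(c U) = Σ_{h ≤ N} (Σ_{U : c U = h} w U)·F h`.
[folklore] -/
theorem sum_mul_apply_eq_sum_fiber {α : Type*} (𝒰 : Finset α) (w : α → ℝ) (c : α → ℕ) (F : ℕ → ℝ) (N : ℕ)
    (hc : ∀ U ∈ 𝒰, c U ≤ N) :
    ∑ U ∈ 𝒰, w U * F (c U) = ∑ h ∈ Finset.range (N + 1), (∑ U ∈ 𝒰.filter (fun U => c U = h), w U) * F h := by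
  rw [← Finset.sum_fiberwise_of_maps_to (s := 𝒰) (t := Finset.range (N + 1)) (g := c)
    (fun U hU => Finset.mem_range.2 (Nat.lt_succ_of_le (hc U hU)))]
  refine Finset.sum_congr rfl fun h _ => ?_
  rw [Finset.sum_mul]
  refine Finset.sum_congr rfl fun U hU => ?_
  rw [(Finset.mem_filter.1 hU).2]

/-! ### 1. Planting a component on the pool: configuration expansion -/

/-- **Configuration expansion.**  Spare sure index `u` (`g u = 1`), pool `B ∌ u` of spare dead indices at the level of `u` (`a = 0` on `B`);
plant sizes `s` and gates `γ` on the pool and a sure blob of size `h` at `u`.  Then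
`TAIL[D, q, lv, (s on B, a[u ↦ h] off B), (γ on B, g off B), j] = Σ_{S ⊆ B} wt_γ^B(S) · TAIL[D, q, lv, a[u ↦ h + Σ_{β∈S} s β], g, j]`.
[this work] -/
theorem tail_pool_eq_sum (D : ℕ) (q : ℕ → ℝ) (lv : κ → ℕ) (a : κ → ℕ) (g : κ → ℝ) (j : ℕ) (u : κ) (hgu : g u = 1)
    (s : κ → ℕ) (γ : κ → ℝ) :
    ∀ (B : Finset κ), u ∉ B → (∀ β ∈ B, lv β = lv u) → (∀ β ∈ B, a β = 0) → ∀ (h : ℕ),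
    TAIL[D, q, lv, (fun k => if k ∈ B then s k else Function.update a u h k),
        (fun k => if k ∈ B then γ k else g k), j] =
      ∑ S ∈ B.powerset, (∏ β ∈ B, (if β ∈ S then γ β else 1 - γ β)) *
        TAIL[D, q, lv, Function.update a u (h + ∑ β ∈ S, s β), g, j] := by
  intro B
  induction B using Finset.induction_on with
  | empty =>
    intro _ _ _ h
    have ha : (fun k => if k ∈ (∅ : Finset κ) then s k else Function.update a u h k) = Function.update a u h := by
      funext k; rw [if_neg (Finset.notMem_empty k)]
    have hg : (fun k => if k ∈ (∅ : Finset κ) then γ k else g k) = g := by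
      funext k; rw [if_neg (Finset.notMem_empty k)]
    rw [ha, hg, Finset.powerset_empty, Finset.sum_singleton, Finset.prod_empty, one_mul, Finset.sum_empty, add_zero]
  | insert β B' hβB' ih =>
    intro huB hlvB haB h
    have huβ : u ≠ β := fun e => huB (e ▸ Finset.mem_insert_self β B')
    have hβu : β ≠ u := fun e => huβ e.symm
    have huB' : u ∉ B' := fun e => huB (Finset.mem_insert_of_mem e)
    have hlvB' : ∀ β' ∈ B', lv β' = lv u := fun β' hβ' => hlvB β' (Finset.mem_insert_of_mem hβ')
    have haB' : ∀ β' ∈ B', a β' = 0 := fun β' hβ' => haB β' (Finset.mem_insert_of_mem hβ')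
    have hlvβ : lv β = lv u := hlvB β (Finset.mem_insert_self β B')
    have haβ : a β = 0 := haB β (Finset.mem_insert_self β B')
    -- the planted functions for `insert β B'` versus `B'`
    set aI : κ → ℕ := fun k => if k ∈ insert β B' then s k else Function.update a u h k with haI
    set gI : κ → ℝ := fun k => if k ∈ insert β B' then γ k else g k with hgI
    set a0 : κ → ℕ := fun k => if k ∈ B' then s k else Function.update a u h k with ha0
    set a1 : κ → ℕ := fun k => if k ∈ B' then s k else Function.update a u (h + s β) k with ha1
    set g0 : κ → ℝ := fun k => if k ∈ B' then γ k else g k with hg0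
    have hgIβ : gI β = γ β := by simp only [hgI, Finset.mem_insert, true_or, if_true]
    -- closed branch: `β` dead, its gate forgotten
    have hclosed : TAIL[D, q, lv, Function.update aI β 0, gI, j] = TAIL[D, q, lv, a0, g0, j] := by
      have hA : Function.update aI β 0 = a0 := by
        funext k
        by_cases hk : k = β
        · subst hk
          rw [Function.update_self, ha0]
          simp only [if_neg hβB', Function.update_of_ne hβu, haβ]
        · rw [Function.update_of_ne hk, haI, ha0]
          simp only [Finset.mem_insert, hk, false_or]
      have hG : gI = Function.update g0 β (γ β) := by
        funext k
        by_cases hk : k = β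
        · subst hk; rw [Function.update_self, hgIβ]
        · rw [Function.update_of_ne hk, hgI, hg0]
          simp only [Finset.mem_insert, hk, false_or]
      have hdead : a0 β = 0 := by rw [ha0]; simp only [if_neg hβB', Function.update_of_ne hβu, haβ]
      rw [hA, hG, tail_update_dead D q lv a0 g0 j β (γ β) hdead]
    -- open branch: `β` sure, its size moved onto `u`
    have hopen : TAIL[D, q, lv, aI, Function.update gI β 1, j] = TAIL[D, q, lv, a1, g0, j] := by
      have hGu : Function.update gI β 1 u = 1 := by
        rw [Function.update_of_ne huβ, hgI]; simp only [if_neg huB, hgu]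
      rw [tail_sure_transfer D q lv aI (Function.update gI β 1) j u β huβ hlvβ hGu (Function.update_self ..)]
      have hA : Function.update (Function.update aI β 0) u (aI u + aI β) = a1 := by
        have hu' : aI u = h := by rw [haI]; simp only [if_neg huB, Function.update_self]
        have hβ' : aI β = s β := by rw [haI]; simp only [Finset.mem_insert, true_or, if_true]
        funext k
        by_cases hku : k = u
        · subst hku
          rw [Function.update_self, hu', hβ', ha1]
          simp only [if_neg huB', Function.update_self]
        · rw [Function.update_of_ne hku]
          by_cases hkβ : k = β
          · subst hkβ
            rw [Function.update_self, ha1]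
            simp only [if_neg hβB', Function.update_of_ne hβu, haβ]
          · rw [Function.update_of_ne hkβ, haI, ha1]
            simp only [Finset.mem_insert, hkβ, false_or]
            by_cases hkB : k ∈ B'
            · rw [if_pos hkB, if_pos hkB]
            · rw [if_neg hkB, if_neg hkB, Function.update_of_ne hku, Function.update_of_ne hku]
      have hdead : a1 β = 0 := by rw [ha1]; simp only [if_neg hβB', Function.update_of_ne hβu, haβ]
      have hG : Function.update gI β 1 = Function.update g0 β 1 := by
        funext k
        by_cases hk : k = β
        · subst hk; rw [Function.update_self, Function.update_self]
        · rw [Function.update_of_ne hk, Function.update_of_ne hk, hgI, hg0]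
          simp only [Finset.mem_insert, hk, false_or]
      rw [hA, hG, tail_update_dead D q lv a1 g0 j β 1 hdead]
    rw [tail_gate_split D q lv aI gI j β, hgIβ, hopen, hclosed, ih huB' hlvB' haB' (h + s β), ih huB' hlvB' haB' h,
      Finset.sum_powerset_insert hβB', add_comm, Finset.mul_sum, Finset.mul_sum]
    congr 1
    · refine Finset.sum_congr rfl fun S hS => ?_
      have hβS : β ∉ S := fun e => hβB' (Finset.mem_powerset.1 hS e)
      rw [Finset.prod_insert hβB', if_neg hβS, mul_assoc]
    · refine Finset.sum_congr rfl fun S hS => ?_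
      have hβS : β ∉ S := fun e => hβB' (Finset.mem_powerset.1 hS e)
      rw [Finset.prod_insert hβB', if_pos (Finset.mem_insert_self β S), mul_assoc, Finset.sum_insert hβS, ← add_assoc]
      congr 2
      exact Finset.prod_congr rfl fun x hx =>
        if_congr (Finset.mem_insert.trans (or_iff_right (ne_of_mem_of_not_mem hx hβB'))).symm rfl rfl

/-! ### 2. The mixture wrapper -/

/-- **THE MIXTURE WRAPPER (configuration form).**  Canonical block-comb with floor `0 < x ≤ ∏_{i<D} q i` and live marginals `≥ x`; spare sure
index `u` (`a u = 0`, `g u = 1`, `lv u ≤ D`), pool `B ∌ u` at the level of `u` (`a = 0` on `B`); components `r ∈ R` (weights `λ_r ≥ 0` summing to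
`1`, sizes `s_r`, gates `γ_r ∈ [0,1]` on `B`) whose live blobs have marginal `(∏_{i<lv u} q)·γ_r β ≥ x` and whose means all equal `m̄`; budget
`2j < Σ_k a k·marginal k + (∏_{i<lv u} q)·m̄`.  Then `x ≤ Σ_r λ_r · Σ_{S ⊆ B} wt_{γ_r}^B(S) · TAIL[D, q, lv, a[u ↦ Σ_{β∈S} s_r β], g, j]` —
each component is a block-comb closed by census-1's `tail_ge_of_mean_le`, expanded by `tail_pool_eq_sum`. [this work] -/
theorem tail_ge_of_mixture (D : ℕ) (q : ℕ → ℝ) (hq : ∀ i, 0 ≤ q i ∧ q i ≤ 1) (lv : κ → ℕ) (a : κ → ℕ)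
    (g : κ → ℝ) (hg : ∀ k, 0 ≤ g k ∧ g k ≤ 1) (j : ℕ) (hlv : ∀ k, 0 < a k → lv k ≤ D)
    (u : κ) (hlu : lv u ≤ D) (hau : a u = 0) (hgu : g u = 1)
    (B : Finset κ) (huB : u ∉ B) (hlvB : ∀ β ∈ B, lv β = lv u) (haB : ∀ β ∈ B, a β = 0)
    {ρ : Type*} (R : Finset ρ) (lam : ρ → ℝ) (hlam : ∀ r ∈ R, 0 ≤ lam r) (hlam1 : ∑ r ∈ R, lam r = 1)
    (s : ρ → κ → ℕ) (γ : ρ → κ → ℝ) (hγ : ∀ r ∈ R, ∀ β ∈ B, 0 ≤ γ r β ∧ γ r β ≤ 1)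
    (x : ℝ) (hx0 : 0 < x) (hxle : x ≤ ∏ i ∈ Finset.range D, q i)
    (hmarg : ∀ k, 0 < a k → x ≤ (∏ i ∈ Finset.range (lv k), q i) * g k)
    (hmargB : ∀ r ∈ R, ∀ β ∈ B, 0 < s r β → x ≤ (∏ i ∈ Finset.range (lv u), q i) * γ r β)
    (mbar : ℝ) (hmean : ∀ r ∈ R, ∑ β ∈ B, (s r β : ℝ) * γ r β = mbar)
    (hbudget : (2 * j : ℝ) < ∑ k, (a k : ℝ) * ((∏ i ∈ Finset.range (lv k), q i) * g k) +
      (∏ i ∈ Finset.range (lv u), q i) * mbar) :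
    x ≤ ∑ r ∈ R, lam r * ∑ S ∈ B.powerset, (∏ β ∈ B, (if β ∈ S then γ r β else 1 - γ r β)) *
        TAIL[D, q, lv, Function.update a u (∑ β ∈ S, s r β), g, j] := by
  -- each component gives the floor
  have hcomp : ∀ r ∈ R, x ≤ ∑ S ∈ B.powerset, (∏ β ∈ B, (if β ∈ S then γ r β else 1 - γ r β)) *
      TAIL[D, q, lv, Function.update a u (∑ β ∈ S, s r β), g, j] := by
    intro r hr
    have hexp := tail_pool_eq_sum D q lv a g j u hgu (s r) (γ r) B huB hlvB haB 0
    simp only [zero_add] at hexp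
    rw [← hexp]
    have ha0 : Function.update a u 0 = a := Function.update_eq_self_iff.2 hau.symm
    rw [ha0]
    -- the planted block-comb
    refine tail_ge_of_mean_le D q hq lv _ _ ?_ j ?_ x hx0 hxle ?_ ?_
    · intro k
      by_cases hk : k ∈ B
      · simp only [if_pos hk]; exact hγ r hr k hk
      · simp only [if_neg hk]; exact hg k
    · intro k hk
      by_cases hkB : k ∈ B
      · rw [hlvB k hkB]; exact hlu
      · simp only [if_neg hkB] at hk; exact hlv k hk
    · intro k hk
      by_cases hkB : k ∈ B
      · simp only [if_pos hkB] at hk ⊢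
        rw [hlvB k hkB]
        exact hmargB r hr k hkB hk
      · simp only [if_neg hkB] at hk ⊢
        exact hmarg k hk
    · -- the budget: the block-comb part plus the component's mean
      have hsplit : ∑ k, ((if k ∈ B then s r k else a k : ℕ) : ℝ) *
          ((∏ i ∈ Finset.range (lv k), q i) * (if k ∈ B then γ r k else g k)) =
          ∑ k, (a k : ℝ) * ((∏ i ∈ Finset.range (lv k), q i) * g k) + (∏ i ∈ Finset.range (lv u), q i) * mbar := by
        rw [← Finset.sum_add_sum_compl B, ← Finset.sum_add_sum_compl B (fun k => (a k : ℝ) * _)]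
        have h1 : ∑ k ∈ B, ((if k ∈ B then s r k else a k : ℕ) : ℝ) *
            ((∏ i ∈ Finset.range (lv k), q i) * (if k ∈ B then γ r k else g k)) =
            (∏ i ∈ Finset.range (lv u), q i) * mbar := by
          rw [← hmean r hr, Finset.mul_sum]
          refine Finset.sum_congr rfl fun k hk => ?_
          rw [if_pos hk, if_pos hk, hlvB k hk]
          ring
        have h2 : ∑ k ∈ Bᶜ, ((if k ∈ B then s r k else a k : ℕ) : ℝ) *
            ((∏ i ∈ Finset.range (lv k), q i) * (if k ∈ B then γ r k else g k)) =
            ∑ k ∈ Bᶜ, (a k : ℝ) * ((∏ i ∈ Finset.range (lv k), q i) * g k) := by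
          refine Finset.sum_congr rfl fun k hk => ?_
          have hkB : k ∉ B := Finset.mem_compl.1 hk
          rw [if_neg hkB, if_neg hkB]
        have h3 : ∑ k ∈ B, (a k : ℝ) * ((∏ i ∈ Finset.range (lv k), q i) * g k) = 0 :=
          Finset.sum_eq_zero fun k hk => by rw [haB k hk, Nat.cast_zero, zero_mul]
        rw [h1, h2, h3]
        ring
      rw [hsplit]
      exact hbudget
  -- convex combination
  calc x = ∑ r ∈ R, lam r * x := by rw [← Finset.sum_mul, hlam1, one_mul]
    _ ≤ _ := Finset.sum_le_sum fun r hr => mul_le_mul_of_nonneg_left (hcomp r hr) (hlam r hr)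

/-- **THE MIXTURE WRAPPER (law form): an x-admissible side law gives the row.**  In the setting of `tail_ge_of_mixture`, if every component
carries at most `N` relays and `π h = Σ_r λ_r · wt_{γ_r}^B{S ⊆ B : Σ_{β∈S} s_r β = h}` for `h ≤ N`, then
`x ≤ Σ_{h ≤ N} π h · TAIL[D, q, lv, a[u ↦ h], g, j]`. [this work] -/
theorem tail_ge_of_mixture_law (D : ℕ) (q : ℕ → ℝ) (hq : ∀ i, 0 ≤ q i ∧ q i ≤ 1) (lv : κ → ℕ) (a : κ → ℕ)
    (g : κ → ℝ) (hg : ∀ k, 0 ≤ g k ∧ g k ≤ 1) (j : ℕ) (hlv : ∀ k, 0 < a k → lv k ≤ D)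
    (u : κ) (hlu : lv u ≤ D) (hau : a u = 0) (hgu : g u = 1)
    (B : Finset κ) (huB : u ∉ B) (hlvB : ∀ β ∈ B, lv β = lv u) (haB : ∀ β ∈ B, a β = 0)
    {ρ : Type*} (R : Finset ρ) (lam : ρ → ℝ) (hlam : ∀ r ∈ R, 0 ≤ lam r) (hlam1 : ∑ r ∈ R, lam r = 1)
    (s : ρ → κ → ℕ) (γ : ρ → κ → ℝ) (hγ : ∀ r ∈ R, ∀ β ∈ B, 0 ≤ γ r β ∧ γ r β ≤ 1)
    (x : ℝ) (hx0 : 0 < x) (hxle : x ≤ ∏ i ∈ Finset.range D, q i)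
    (hmarg : ∀ k, 0 < a k → x ≤ (∏ i ∈ Finset.range (lv k), q i) * g k)
    (hmargB : ∀ r ∈ R, ∀ β ∈ B, 0 < s r β → x ≤ (∏ i ∈ Finset.range (lv u), q i) * γ r β)
    (mbar : ℝ) (hmean : ∀ r ∈ R, ∑ β ∈ B, (s r β : ℝ) * γ r β = mbar)
    (hbudget : (2 * j : ℝ) < ∑ k, (a k : ℝ) * ((∏ i ∈ Finset.range (lv k), q i) * g k) +
      (∏ i ∈ Finset.range (lv u), q i) * mbar)
    (N : ℕ) (hN : ∀ r ∈ R, ∑ β ∈ B, s r β ≤ N) (π : ℕ → ℝ)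
    (hπ : ∀ h, h ≤ N → π h = ∑ r ∈ R, lam r *
      ∑ S ∈ B.powerset.filter (fun S => ∑ β ∈ S, s r β = h), ∏ β ∈ B, (if β ∈ S then γ r β else 1 - γ r β)) :
    x ≤ ∑ h ∈ Finset.range (N + 1), π h * TAIL[D, q, lv, Function.update a u h, g, j] := by
  have hmix := tail_ge_of_mixture D q hq lv a g hg j hlv u hlu hau hgu B huB hlvB haB R lam hlam hlam1 s γ hγ x hx0 hxle
    hmarg hmargB mbar hmean hbudget
  refine hmix.trans (le_of_eq ?_)
  -- regroup every component by the number of relays carried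
  have hreg : ∀ r ∈ R, ∑ S ∈ B.powerset, (∏ β ∈ B, (if β ∈ S then γ r β else 1 - γ r β)) *
      TAIL[D, q, lv, Function.update a u (∑ β ∈ S, s r β), g, j] =
      ∑ h ∈ Finset.range (N + 1), (∑ S ∈ B.powerset.filter (fun S => ∑ β ∈ S, s r β = h),
        ∏ β ∈ B, (if β ∈ S then γ r β else 1 - γ r β)) * TAIL[D, q, lv, Function.update a u h, g, j] := by
    intro r hr
    exact sum_mul_apply_eq_sum_fiber B.powerset (fun S => ∏ β ∈ B, (if β ∈ S then γ r β else 1 - γ r β))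
      (fun S => ∑ β ∈ S, s r β) (fun h => TAIL[D, q, lv, Function.update a u h, g, j]) N
      (fun S hS => (Finset.sum_le_sum_of_subset (Finset.mem_powerset.1 hS)).trans (hN r hr))
  have hL : ∑ r ∈ R, lam r * ∑ S ∈ B.powerset, (∏ β ∈ B, (if β ∈ S then γ r β else 1 - γ r β)) *
      TAIL[D, q, lv, Function.update a u (∑ β ∈ S, s r β), g, j] =
      ∑ r ∈ R, ∑ h ∈ Finset.range (N + 1), lam r *
        ((∑ S ∈ B.powerset.filter (fun S => ∑ β ∈ S, s r β = h), ∏ β ∈ B, (if β ∈ S then γ r β else 1 - γ r β)) *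
          TAIL[D, q, lv, Function.update a u h, g, j]) := by
    refine Finset.sum_congr rfl fun r hr => ?_
    rw [hreg r hr, Finset.mul_sum]
  have hR : ∑ h ∈ Finset.range (N + 1), π h * TAIL[D, q, lv, Function.update a u h, g, j] =
      ∑ h ∈ Finset.range (N + 1), ∑ r ∈ R, lam r *
        ((∑ S ∈ B.powerset.filter (fun S => ∑ β ∈ S, s r β = h), ∏ β ∈ B, (if β ∈ S then γ r β else 1 - γ r β)) *
          TAIL[D, q, lv, Function.update a u h, g, j]) := by
    refine Finset.sum_congr rfl fun h hh => ?_
    rw [hπ h (Nat.le_of_lt_succ (Finset.mem_range.1 hh)), Finset.sum_mul]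
    refine Finset.sum_congr rfl fun r _ => ?_
    ring
  rw [hL, hR, Finset.sum_comm]

end BlockComb

end Quant

end Summit.CriticalPhenomena.PercolationContinuityZ3.Theorems

end
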